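import Literature.MathematicalPhysics.QuantumFieldTheory.Balaban1983to89.B6Prop22HolderMultiLevelBoxL0
import Literature.MathematicalPhysics.QuantumFieldTheory.Balaban1983to89.B6Prop22HolderTwoLevelBoxRateUnifL0
import Literature.MathematicalPhysics.QuantumFieldTheory.Balaban1983to89.B6Prop22HolderMultiLevelBoxRateUnif
/-!
# `Balaban1983to89.B6Prop22HolderMultiLevelBoxRateUnifL0` — LEVEL-0 TWIN (programme G-F3′-L0, director-ym LINE №27 / UV3-NODE §24.5; plan `lit-balaban-r03/G-F3L0-PLAN.md`) of `B6Prop22HolderMultiLevelBoxRateUnif`: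
the same declarations, SAME NAMES AND STATEMENTS, for nested families WITH print's region `Λ₀ = T ∖ Ω₁` ADMITTED (structures
`B6MultiLevelBoxOperatorL0.Domains` / `B6MultiLevelTorusOperatorL0.TDomains`: levels `0, …, k`, the level-`0` block a single site, `Q′₀ = id`,
finite weight `a₀` — print p.225 (2.14) «Σ_{j=0}^k … (Q′₀λ)(x) = λ(x), x ∈ Λ₀», p.229 «taking a sequence (2.1) … smallest possible domains B^j(Λ_j),
and considering the operator Δ_a defined by (2.19), (2.20) for this sequence»).  Every `D`-free object is the lineage's, consumed BY NAME; no existing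
module is touched; no fact is minted.  Unit `lit-balaban-p21` (packet S-B owner, p21 gen 26; port tooling by r03 gen 36); B6 fold owner r03; referee ref-4.  THE TWIN'S DOCUMENTATION FOLLOWS
VERBATIM (its «levels 1 … k» / «Ω₁ = X» sentences describe the twin; here `j` runs from `0` and `Ω₁` may be a proper subset).

# `Balaban1983to89.B6Prop22HolderMultiLevelBoxRateUnif` — [B6] PROPOSITION 2.2, FOURTH ENTRY OF (2.67)
(`‖ζ∇^η_xG′λ‖_α`) FOR THE GENUINE `k`-LEVEL OPERATOR ON A BOX, WITH THE PRINTED QUANTIFIER ORDER: ONE rate `δ₀` and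
ONE pair of thresholds «M sufficiently large» / (2.59) for ALL Hölder exponents `0 ≤ α < 1`, an `α`-dependent constant —
p21's files 10–11 of the multi-level parametrix (`B6HolderTermMultiLevelBoxL0.aX_dd_le →
B6Prop22HolderMultiLevelBoxL0.holderZero_rowBound → hasMajorant_holder_multiLevelBox → prop22_fourth_multiLevelBox`)
RE-THREADED on top of r03's `B6Prop22HolderTwoLevelBoxRateUnifL0.ineq243_twoLevel_holder_wsum2_unif` (`_unif` twins;
proofs = the originals with the `∃`-witnesses reordered; no existing module is touched; no fact is minted)

FRAMING (verbatim cell line):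
statement-level skeleton of published theorems with citation tags; proofs where landed; nothing here is a claim about the Yang–Mills mass gap

Source under audit (cell pub-balaban / lit-balaban): T. Bałaban, *Propagators and renormalization transformations for
lattice gauge theories. II*, Commun. Math. Phys. **96** (1984) 223–250 [`Balaban1984PropagatorsII`, "B6"], p. 234
[PDF 12] (2.64)–(2.67), Proposition 2.2; p. 230 [PDF 8] (2.43) (renders
`run/shared/lean/pub/pub-balaban/b2b-balaban-ref1/pages/1984-cmp96-propagators-rt-II/…-p008/p012-x2.png`); [3] =
T. Bałaban, *Regularity and decay of lattice Green's functions*, Commun. Math. Phys. **89** (1983) 571–597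
[`Balaban1983RegularityDecay`, "B4"], Theorem (1.9) p. 573: «δ₀, c₀, R₀ … depending on d, M only, c₀ on α also».
PDF held: `paper:balaban1984-cmp96-propagators-rt-ii` (journal page = PDF page + 222).  Unit `lit-balaban-p21`
(Phase-2 proof seat p21 gen 12), HOME `run/shared/lean/pub/lit-balaban/`, B6 fold owner r03 (row **B6.Prop2.2**),
referee ref-4.

## WHAT IS PRINTED (p. 234, verbatim up to notation)

«**Proposition 2.2.** If we have (2.1), (2.2) and M is sufficiently large, then the operator G′ = Δ′_a^{−1} (a = 1)
satisfies the inequalities |(G′λ)(x)|, |(∇^η_xG′λ)(x)|, |(G′∇^{η*}λ)(x)|, ‖ζ∇^η_xG′λ‖_α, ‖ζG′∇^{η*}λ‖_α, |(Δ^ηG′λ)(x)|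
≤ O(1)[(L^jη)², L^jη, L^jη, (L^jη)^{1−α}(‖ζ‖_α + |ζ|), (L^jη)^{1−α}(‖ζ‖_α + |ζ|), 1]·e^{−½δ₀d(y,y′)}|λ|, x ∈ B^j(y) or
supp ζ ⊂ B^j(y), y ∈ Λ_j, supp λ ⊂ B^{j′}(y′), y′ ∈ Λ_{j′}. (2.67)» — with ONE «δ₀» and ONE «M sufficiently large» for
all the entries, the `α`-dependence being in «O(1)» only (the census typing `B6.Prop22Printed`:
`∃ M₁ δ₀ C, ∃ Cα : ℝ → ℝ, … ∀ α`).

## WHY / WHAT THIS FILE CERTIFIES (kernel-checked)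

p21's k-level entry-4 theorems (gen 11) are stated `∀ α ∃ (δ₀, C, M₀, N₀)` because their cube Hölder input
`B6Ineq243HolderTwoLevelBoxL0.ineq243_twoLevel_holder_wsum2` is `∀ α ∃ (δ, c)`.  In the proofs the RATE enters only through
that input (the other cube inputs `ineq243_twoLevel_roww/_deriv_wsum`, the far-pair bound `aX_diff_le` and the
majorant of `R` (`rML_majorant`) are `α`-free), the threshold `M₀ = 2K·c_K + 1` comes from `R` alone and `N₀` from the
rate alone; so with r03's `ineq243_twoLevel_holder_wsum2_unif` (`∃ δ ∀ α ∃ c(α)`) the SAME proofs give print's order: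
* §1 `aX_dd_le_unif` — one cube term over any pair of one block: `∃ δ₄ ∀ α ∈ [0,1) ∃ Q(α)`;
* §2 `holderZero_rowBound_unif` — the pair rows of `T₀ = Dd∘G′₀`: `∃ δ₅ ∀ α ∃ A(α)`;
* §3 `hasMajorant_holder_multiLevelBox_unif` — the lifted fourth entry: `∃ δ₀ M₀ N₀ ∀ α ∃ C(α)`, and
  **`prop22_fourth_multiLevelBox_unif`** — (2.67)₄ for the genuine `k`-level `G′ = Δ′_a^{−1}` read back on the pairs:
  `∃ δ₀ M₀ N₀ ∀ α ∈ [0,1) ∃ C(α) ∀ k, M_h ≥ 3, L·M_h ≥ M₀, R ≥ 2L, RM ≥ N₀ + 1, P, D, weights, μ, λ, pairs`.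

## HONEST SCOPE

Exactly that of the originals (files 10–11): levels `1 … k` on a Neumann box, `m² = 0`, the asymmetric partition,
`M_h ≥ 3`, `R ≥ 2L`, lattice units (`(L^{j})^{1−α}` for «(L^jη)^{1−α}»), the Hölder pairs = the pairs of ONE block
`B^j(y)`, `ζ` dispensed with as in [3] (1.9), `L`-dependent (2.61)-constant, constants existential (`δ₀`, `M₀`, `N₀`
functions of `d`, `ℓ`, the windows; `C` of these and `α`).  No new estimate — a change of quantifier order justified by
the existing proofs (five private plumbing lemmas of files 10–11 are not importable and are COPIED verbatim as private
lemmas).  NOT summit progress.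
-/

namespace Literature.MathematicalPhysics.QuantumFieldTheory.Balaban1983to89.B6Prop22HolderMultiLevelBoxRateUnifL0

open Finset Matrix
open Literature.MathematicalPhysics.QuantumFieldTheory.Balaban1983to89.B4ContourShift (supNorm supNorm_nonneg
  abs_le_supNorm exists_supNorm_eq)
open Literature.MathematicalPhysics.QuantumFieldTheory.Balaban1983to89.B4Reflection242 (boxDom mem_boxDom blk nbrs
  mem_nbrs)
open Literature.MathematicalPhysics.QuantumFieldTheory.Balaban1983to89.B4Lemma22ReduceZero (Box)
open Literature.MathematicalPhysics.QuantumFieldTheory.Balaban1983to89.B4PartitionUnity22 (hprof D1 D2 D1_nonneg D2_nonneg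
  contDiff_hprof hasCompactSupport_hprof)
open Literature.MathematicalPhysics.QuantumFieldTheory.Balaban1983to89.B4Thm110ZeroBox (boxCast boxCast_apply_val
  boxCast_symm_apply_val mem_boxDom_of_eq roww mulVec_le_of_roww supNorm_sub_le_sub_add_sub)
open Literature.MathematicalPhysics.QuantumFieldTheory.Balaban1983to89.B4Thm110ZeroBoxDeriv (wsum supNorm_single_le
  supNorm_sub_le_nbr)
open Literature.MathematicalPhysics.QuantumFieldTheory.Balaban1983to89.B6Ineq243TwoLevelBox hiding ineq243_twoLevel_deriv_value ineq243_twoLevel_deriv_wsum ineq243_twoLevel_dist ineq243_twoLevel_rowSum_colSum ineq243_twoLevel_roww ineq243_twoLevel_value ineq244_twoLevel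
open Literature.MathematicalPhysics.QuantumFieldTheory.Balaban1983to89.B6Ineq243TwoLevelBoxL0
open Literature.MathematicalPhysics.QuantumFieldTheory.Balaban1983to89.B6Partition236TwoLevelBox
open Literature.MathematicalPhysics.QuantumFieldTheory.Balaban1983to89.B6Eq238TwoLevelBox
open Literature.MathematicalPhysics.QuantumFieldTheory.Balaban1983to89.B6Ineq249TwoLevelBox (near card_near_le
  mem_near_of_abs_lt emb_sub_emb)
open Literature.MathematicalPhysics.QuantumFieldTheory.Balaban1983to89.B6MultiLevelBoxOperator hiding Domains mlOp_apply
open Literature.MathematicalPhysics.QuantumFieldTheory.Balaban1983to89.B6MultiLevelBoxOperatorL0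
open Literature.MathematicalPhysics.QuantumFieldTheory.Balaban1983to89.B6Eq238MultiLevelBox hiding Active CubeData Down Ep LamG aX bX cG cOp cOp_mul_cG ctrs_Pj_subset cubeData_of_mem cubeSet diagonal_mul_eq_pad eq238_multiLevelBox fin fin_data fin_spec gX gZeroML isBlockUnion_LamG lev_corner_ublk mem_LamG mem_cubeSet mlOp_emb_emb mlOp_emb_off mlOp_mul_aX mlOp_mul_term rML row_eq_pad_row sum_uv_eq_one vFun vX window_of_active
open Literature.MathematicalPhysics.QuantumFieldTheory.Balaban1983to89.B6Eq238MultiLevelBoxL0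
open Literature.MathematicalPhysics.QuantumFieldTheory.Balaban1983to89.B6Ineq249MultiLevelBox hiding abs_vFun_le_one bX_eq bX_mulVec_apply embC eq250_multiLevelBox innerB local_comm_bound mem_keySet_of_bX_ne_zero norm_rML_le
open Literature.MathematicalPhysics.QuantumFieldTheory.Balaban1983to89.B6Ineq249MultiLevelBoxL0
open Literature.MathematicalPhysics.QuantumFieldTheory.Balaban1983to89.B6Geom246MultiLevelBox hiding Touch blkOf blkOf_corner blkOf_eq_iff_blk blkOf_eq_of_blk_i_eq blkOf_val bond bond_adj bset cen connected coord_bounds corner corner_mem csys dist_blkOf_le_box dist_blkOf_le_coord dist_blkOf_le_line dist_cen_le_of_adj dist_cen_le_of_touch dist_le_one_of_near dist_toR_cen_le exists_blkOf_eq geom lemma21_box lev_corner lev_eq_of_blkOf_eq levelGap pack reachable_blkOf reachable_of_near realizes scale_bounds touch_symm triangle_refl_nonneg walk_disp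
open Literature.MathematicalPhysics.QuantumFieldTheory.Balaban1983to89.B6Geom246MultiLevelBoxL0
open Literature.MathematicalPhysics.QuantumFieldTheory.Balaban1983to89.B6Prop22MultiLevelBox hiding Dd_le_supNorm aX_mulVec_apply bX_row_img bX_row_off dist_blkOf_le_in_cube fixedPoint_gml gX_row_img gX_row_off gZeroML_majorant lev_window_of_inCube mem_keySet_of_aX_ne_zero prop22_first_multiLevelBox rML_majorant
open Literature.MathematicalPhysics.QuantumFieldTheory.Balaban1983to89.B6Prop22MultiLevelBoxL0
open Literature.MathematicalPhysics.QuantumFieldTheory.Balaban1983to89.B6Prop22DerivMultiLevelBox (dMat dMat_mulVec_of_mem)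
open Literature.MathematicalPhysics.QuantumFieldTheory.Balaban1983to89.B6Prop22DerivMultiLevelBoxL0 (img_of_uX_ne_zero mem_keySet_of_uX_ne_zero)
open Literature.MathematicalPhysics.QuantumFieldTheory.Balaban1983to89.B6Prop22HolderTwoLevelBox (exists_emb_eq_of_near
  abs_hq_dd_le wsum_longDiff_le)
open Literature.MathematicalPhysics.QuantumFieldTheory.Balaban1983to89.B6RandomWalk (HasMajorant BlockSupp
  hasMajorant_mono)
open Literature.MathematicalPhysics.QuantumFieldTheory.Balaban1983to89.B6Ineq261LevelGap (K261 K261_nonneg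
  theta_lt_one_of_log)
open Literature.MathematicalPhysics.QuantumFieldTheory.Balaban1983to89.B6Prop23Chain (majorant_of_fixedPoint_266W)
open Literature.MathematicalPhysics.QuantumFieldTheory.Balaban1983to89.B6HolderTermMultiLevelBoxL0 (aX_diff_le aX_dd_near_le supNorm_le_of_blkOf_eq)
open Literature.MathematicalPhysics.QuantumFieldTheory.Balaban1983to89.B6Prop22HolderMultiLevelBox (liftL liftR hasMajorant_liftL hasMajorant_liftR rowBound_of_hasMajorant_liftL)
open Literature.MathematicalPhysics.QuantumFieldTheory.Balaban1983to89.B6Prop22HolderMultiLevelBoxL0 (HPair blkP Dd holderOp holderOp_apply fixedPoint_holder)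
open Literature.MathematicalPhysics.QuantumFieldTheory.Balaban1983to89.B6Prop22HolderTwoLevelBoxRateUnif hiding ineq243_twoLevel_holder_wsum2_unif
open Literature.MathematicalPhysics.QuantumFieldTheory.Balaban1983to89.B6Prop22HolderTwoLevelBoxRateUnifL0
  (ineq243_twoLevel_holder_wsum2_unif)

noncomputable section

variable {d : ℕ}

/-! ## §0 Tools (private copies of the non-importable plumbing of files 10–11) -/

section Tools

/-- a sum over a finite type whose non-zero terms are indexed injectively into a finset `T` and are bounded by
`B ≥ 0` is at most `|T|·B`. [folklore] -/
private theorem sum_le_card_mul {ι σ : Type*} [Fintype ι] [DecidableEq σ] (f : ι → ℝ) (key : ι → σ)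
    (hkey : Function.Injective key) (T : Finset σ) (hT : ∀ i, f i ≠ 0 → key i ∈ T) {B : ℝ} (hB : 0 ≤ B)
    (hf : ∀ i, f i ≤ B) : ∑ i, f i ≤ T.card * B := by
  classical
  rw [← Finset.sum_filter_ne_zero]
  have hcard : (Finset.univ.filter fun i => f i ≠ 0).card ≤ T.card :=
    Finset.card_le_card_of_injOn key (fun i hi => by
      rw [Finset.coe_filter] at hi; exact hT i hi.2) (fun i _ j _ h => hkey h)
  calc ∑ i ∈ Finset.univ.filter (fun i => f i ≠ 0), f i
      ≤ (Finset.univ.filter fun i => f i ≠ 0).card • B := Finset.sum_le_card_nsmul _ _ _ fun i _ => hf i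
    _ = ((Finset.univ.filter fun i => f i ≠ 0).card : ℝ) * B := by rw [nsmul_eq_mul]
    _ ≤ T.card * B := mul_le_mul_of_nonneg_right (by exact_mod_cast hcard) hB

/-- the weakening of a rate against a non-negative distance. [folklore] -/
private theorem exp_rate_mono {δ δ' dist : ℝ} (hδ : δ' ≤ δ) (hdist : 0 ≤ dist) (d : ℕ) :
    Real.exp (-(δ / (d + 1) * dist)) ≤ Real.exp (-(δ' / (d + 1) * dist)) := by
  rw [Real.exp_le_exp, neg_le_neg_iff]
  exact mul_le_mul_of_nonneg_right (div_le_div_of_nonneg_right hδ (by positivity)) hdist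

/-- Hölder weights, far pairs: `s^{−α}·T ≤ L·T^{1−α}` when `T ≤ L·n`, `n ≤ s`, `0 ≤ α ≤ 1`, `L ≥ 1`, `n, T > 0`.
[folklore] -/
private theorem rpow_far_le {n s T L α : ℝ} (hn : 0 < n) (hns : n ≤ s) (hT : 0 < T) (hTL : T ≤ L * n)
    (hL : 1 ≤ L) (hα0 : 0 ≤ α) (hα1 : α ≤ 1) : s ^ (-α) * T ≤ L * T ^ (1 - α) := by
  have hL0 : 0 < L := by linarith
  -- `s^{−α} ≤ n^{−α} ≤ (T/L)^{−α} = L^{α}·T^{−α} ≤ L·T^{−α}`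
  have h1 : s ^ (-α) ≤ n ^ (-α) := Real.rpow_le_rpow_of_nonpos hn hns (by linarith)
  have hTLn : T / L ≤ n := by rw [div_le_iff₀ hL0]; linarith
  have h2 : n ^ (-α) ≤ (T / L) ^ (-α) := Real.rpow_le_rpow_of_nonpos (div_pos hT hL0) hTLn (by linarith)
  have h3 : (T / L) ^ (-α) = L ^ α * T ^ (-α) := by
    rw [Real.div_rpow hT.le hL0.le, Real.rpow_neg hT.le, Real.rpow_neg hL0.le]
    field_simp
  have h4 : L ^ α ≤ L := B4Thm19ZeroBoxHolder.rpow_le_self_of_one_le hL hα1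
  have h5 : T ^ (-α) * T = T ^ (1 - α) := by
    rw [show (1 : ℝ) - α = -α + 1 by ring, Real.rpow_add hT, Real.rpow_one]
  have hTα : 0 ≤ T ^ (-α) := Real.rpow_nonneg hT.le _
  calc s ^ (-α) * T ≤ L ^ α * T ^ (-α) * T := by
        refine mul_le_mul_of_nonneg_right (h1.trans (h2.trans h3.le)) hT.le
    _ ≤ L * T ^ (-α) * T := by gcongr
    _ = L * T ^ (1 - α) := by rw [mul_assoc, h5]

end Tools

/-! ## §1 One cube term over any pair of one block, rate uniform in `α` -/

section OneTerm

variable {ℓ Mh k R : ℕ} {P : Fin (d + 1) → ℕ} {D : Domains d ℓ Mh k P R} {a c : ℕ → ℝ}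

/-- the value of a cube term vanishes where its cut-off does. [cite: Balaban1984PropagatorsII, (2.37) p.229, dictionary] -/
private theorem aX_apply_eq_zero (hP : ∀ μ, 1 ≤ P μ) (cq : ℕ × (Fin (d + 1) → ℤ)) (hc : CubeData D cq)
    (lam : ↥(boxDom (N0 ℓ Mh k P)) → ℝ) {z : ↥(boxDom (N0 ℓ Mh k P))}
    (hz : uX (ℓ := ℓ) (Mh := Mh) (k := k) (P := P) cq z = 0) : (aX D a c hP cq hc *ᵥ lam) z = 0 := by
  rw [aX_mulVec_apply, hz, zero_mul]

/-- a site where a cube term's bond difference is non-trivial lies in the cube: its level is in the window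
`[i_□, i_□ + 1]`. [cite: Balaban1984PropagatorsII, (2.2) p.224 with p.230; Balaban1983RegularityDecay, (2.6) p.576] -/
private theorem lev_window_of_uX_or (hℓ : 1 ≤ ℓ) (hR : 2 * (ℓ + 1) ≤ R) (hP : ∀ μ, 1 ≤ P μ) (hMh : 2 ≤ Mh)
    (cq : ℕ × (Fin (d + 1) → ℤ)) (hc : CubeData D cq) {μ : Fin (d + 1)} (x : ↥(boxDom (N0 ℓ Mh k P)))
    (hxe : x.1 + Pi.single μ 1 ∈ boxDom (N0 ℓ Mh k P))
    (hu : uX (ℓ := ℓ) (Mh := Mh) (k := k) (P := P) cq x ≠ 0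
      ∨ uX (ℓ := ℓ) (Mh := Mh) (k := k) (P := P) cq ⟨x.1 + Pi.single μ 1, hxe⟩ ≠ 0) :
    fin D cq.1 cq.2 ≤ D.lev x.1 ∧ D.lev x.1 ≤ fin D cq.1 cq.2 + 1 := by
  obtain ⟨-, hij, hji, -, -⟩ := fin_data hc
  have hjk := hc.hj.2
  have hx_nb : x.1 ∈ nbrs (⟨x.1 + Pi.single μ 1, hxe⟩ : ↥(boxDom (N0 ℓ Mh k P))).1 :=
    mem_nbrs.2 ⟨μ, Or.inr (by rw [add_sub_cancel_right])⟩
  obtain ⟨y, hy⟩ : ∃ y, embC D hP cq hc y = (castP (ℓ := ℓ) (Mh := Mh) (P := P) hij hjk).symm x := by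
    rcases hu with h | h
    · exact img_of_uX_ne_zero hℓ hP hMh cq hc h (Or.inr rfl)
    · exact img_of_uX_ne_zero hℓ hP hMh cq hc h (Or.inl hx_nb)
  have hzval : ((castP (ℓ := ℓ) (Mh := Mh) (P := P) hij hjk).symm x).1 = x.1 := by
    unfold castP; exact boxCast_symm_apply_val _ _
  have hxin : InCube ℓ Mh k P cq.1 cq.2 x.1 := by
    rw [← hzval]; exact (inCube_iff_exists_emb (Mh := Mh) hP hij hc.hq _).2 ⟨y, hy⟩
  exact lev_window_of_inCube hℓ hR hP hMh hc x.2 hxin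

/-- **ONE TERM OF THE HÖLDER-WEIGHTED MIXED DIFFERENCE OF `G′₀`, RATE UNIFORM IN `α`** — p21's
`B6HolderTermMultiLevelBoxL0.aX_dd_le` in print's quantifier order `∃ δ₄ ∀ α ∈ [0,1) ∃ Q(α)`: for every member `□` of the
cover, every pair `x ≠ x′` of one block `B^j(y)` with `x + e_μ`, `x′ + e_μ` in the box and every `λ` supported in the
block `y′` with `|λ| ≤ B`,
`|x′−x|_∞^{−α}·|((h_□G′(□)v_□λ)(x′+e_μ) − (…)(x′)) − ((…)(x+e_μ) − (…)(x))| ≤ (L^{j})^{1−α}·Q·e^{−δ₄d(y,y′)/(d+1)}·B`;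
the rate `δ₄ = min(δ(2.43)₁, δ(2.43)₂, δ_H, δ₃)` is `α`-free because the cube Hölder input is now
`…B6Prop22HolderTwoLevelBoxRateUnifL0.ineq243_twoLevel_holder_wsum2_unif`.  Proof = the original (near pairs by the
four-term product rule `aX_dd_near_le`, far pairs by `aX_diff_le` twice) with the `∃`-witnesses reordered.
[cite: Balaban1984PropagatorsII, (2.64)–(2.67) p.234 («(L^jη)² replaced by … (L^jη)^{1−α}»), (2.43) p.230; Balaban1983RegularityDecay, Theorem (1.9) p.573] -/
theorem aX_dd_le_unif (d ℓ : ℕ) (hℓ : 1 ≤ ℓ) (aminus aplus a2minus a2plus : ℝ) (ha : 0 < aminus)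
    (ha2 : 0 < a2minus) :
    ∃ δ₄ : ℝ, 0 < δ₄ ∧ ∀ (α : ℝ), 0 ≤ α → α < 1 → ∃ Q : ℝ, 0 < Q ∧ ∀ (k Mh R : ℕ), 3 ≤ Mh → 2 * (ℓ + 1) ≤ R →
      ∀ (P : Fin (d + 1) → ℕ) (hP : ∀ μ, 1 ≤ P μ) (D : Domains d ℓ Mh k P R) (a c : ℕ → ℝ),
        (∀ i, aminus ≤ a i ∧ a i ≤ aplus) → (∀ i, a2minus ≤ c i ∧ c i ≤ a2plus) →
        ∀ (μ : Fin (d + 1)) (y' : ↥(bset D)) (lam : ↥(boxDom (N0 ℓ Mh k P)) → ℝ) (B : ℝ),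
          BlockSupp (g := geom D) (blkOf D) lam y' B →
          ∀ (x x' : ↥(boxDom (N0 ℓ Mh k P))), x'.1 ≠ x.1 → blkOf D x' = blkOf D x →
          ∀ (hxe : x.1 + Pi.single μ 1 ∈ boxDom (N0 ℓ Mh k P)) (hxe' : x'.1 + Pi.single μ 1 ∈ boxDom (N0 ℓ Mh k P))
            (cq : ℕ × (Fin (d + 1) → ℤ)) (hc : CubeData D cq),
            (supNorm (x'.1 - x.1)) ^ (-α)
                * |((aX D a c hP cq hc *ᵥ lam) ⟨x'.1 + Pi.single μ 1, hxe'⟩ - (aX D a c hP cq hc *ᵥ lam) x')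
                    - ((aX D a c hP cq hc *ᵥ lam) ⟨x.1 + Pi.single μ 1, hxe⟩ - (aX D a c hP cq hc *ᵥ lam) x)|
              ≤ (((ℓ : ℝ) + 1) ^ D.lev x.1) ^ (1 - α)
                * (Q * Real.exp (-(δ₄ / (d + 1) * (geom D).dist (blkOf D x) y')) * B) := by
  obtain ⟨δ'', c', hδ'', hc', h243⟩ := ineq243_twoLevel_roww d ℓ hℓ aminus aplus 0 a2minus a2plus ha ha2
  obtain ⟨δd, cd, hδd, hcd, h243d⟩ := ineq243_twoLevel_deriv_wsum d ℓ hℓ aminus aplus 0 a2minus a2plus ha ha2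
  obtain ⟨δH, hδH, hHA⟩ := ineq243_twoLevel_holder_wsum2_unif d ℓ hℓ aminus aplus 0 a2minus a2plus ha ha2
  obtain ⟨δ₃, Q₃, hδ₃, hQ₃, hfar⟩ := aX_diff_le d ℓ hℓ aminus aplus a2minus a2plus ha ha2
  have hD1 := D1_nonneg contDiff_hprof hasCompactSupport_hprof
  have hD2 := D2_nonneg contDiff_hprof hasCompactSupport_hprof
  obtain ⟨δ₄, hδ₄⟩ : ∃ t : ℝ, t = min (min δ'' δd) (min δH δ₃) := ⟨_, rfl⟩
  have hδ₄pos : 0 < δ₄ := by rw [hδ₄]; exact lt_min (lt_min hδ'' hδd) (lt_min hδH hδ₃)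
  have h41 : δ₄ ≤ δ'' := by rw [hδ₄]; exact (min_le_left _ _).trans (min_le_left _ _)
  have h42 : δ₄ ≤ δd := by rw [hδ₄]; exact (min_le_left _ _).trans (min_le_right _ _)
  have h43 : δ₄ ≤ δH := by rw [hδ₄]; exact (min_le_right _ _).trans (min_le_left _ _)
  have h44 : δ₄ ≤ δ₃ := by rw [hδ₄]; exact (min_le_right _ _).trans (min_le_right _ _)
  refine ⟨δ₄, hδ₄pos, fun α hα0 hα1 => ?_⟩
  obtain ⟨cH, hcH, hH⟩ := hHA α hα0 hα1
  obtain ⟨Qn, hQn⟩ : ∃ t : ℝ, t = (D2 hprof + d * D1 hprof ^ 2) * (c' * (Real.exp δ'' * Real.exp δ''))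
      + (d + 1) * D1 hprof * (cd * (Real.exp δd * Real.exp δd))
      + (d + 1) * ((d + 1) * D1 hprof) * (cd * (Real.exp δd * Real.exp δd * (Real.exp δd * Real.exp δd)))
      + cH * (Real.exp δH * Real.exp δH) := ⟨_, rfl⟩
  have hQn0 : 0 ≤ Qn := by rw [hQn]; positivity
  refine ⟨Qn + 2 * ((ℓ : ℝ) + 1) * Q₃ + 1, by positivity, ?_⟩
  intro k Mh R hMh hR P hP D a c haw hcw μ y' lam B hlam x x' hne hblk hxe hxe' cq hc
  obtain ⟨-, hij, hji, -, -⟩ := fin_data hc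
  have hMh1 : 1 ≤ Mh := le_trans (by norm_num) hMh
  have hMh2 : 2 ≤ Mh := le_trans (by norm_num) hMh
  have hL1 : (1 : ℝ) ≤ (ℓ : ℝ) + 1 := by linarith [(Nat.cast_nonneg ℓ : (0 : ℝ) ≤ ℓ)]
  have hB0 : 0 ≤ B := hlam.nonneg
  have hdnn : 0 ≤ (geom D).dist (blkOf D x) y' := (triangle_refl_nonneg D hMh1 hP).2.2 _ _
  obtain ⟨E4, hE4⟩ : ∃ t : ℝ, t = Real.exp (-(δ₄ / (d + 1) * (geom D).dist (blkOf D x) y')) := ⟨_, rfl⟩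
  rw [← hE4]
  have hE40 : 0 ≤ E4 := by rw [hE4]; exact (Real.exp_pos _).le
  obtain ⟨LJ, hLJ⟩ : ∃ t : ℝ, t = ((ℓ : ℝ) + 1) ^ D.lev x.1 := ⟨_, rfl⟩
  rw [← hLJ]
  have hLJ0 : 0 < LJ := by rw [hLJ]; positivity
  have hLJα0 : 0 ≤ LJ ^ (1 - α) := Real.rpow_nonneg hLJ0.le _
  have hRHS0 : 0 ≤ LJ ^ (1 - α) * ((Qn + 2 * ((ℓ : ℝ) + 1) * Q₃ + 1) * E4 * B) := by positivity
  have hs1 : 1 ≤ supNorm (x'.1 - x.1) := B4StripSumsHolder.one_le_supNorm (sub_ne_zero.2 hne)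
  have hs0 : 0 < supNorm (x'.1 - x.1) := lt_of_lt_of_le one_pos hs1
  have hW0 : 0 ≤ (supNorm (x'.1 - x.1)) ^ (-α) := Real.rpow_nonneg hs0.le _
  -- the trivial case: the cut-off vanishes at the four points
  by_cases h0 : uX (ℓ := ℓ) (Mh := Mh) (k := k) (P := P) cq x = 0
      ∧ uX (ℓ := ℓ) (Mh := Mh) (k := k) (P := P) cq ⟨x.1 + Pi.single μ 1, hxe⟩ = 0
      ∧ uX (ℓ := ℓ) (Mh := Mh) (k := k) (P := P) cq x' = 0
      ∧ uX (ℓ := ℓ) (Mh := Mh) (k := k) (P := P) cq ⟨x'.1 + Pi.single μ 1, hxe'⟩ = 0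
  · rw [aX_apply_eq_zero hP cq hc lam h0.1, aX_apply_eq_zero hP cq hc lam h0.2.1, aX_apply_eq_zero hP cq hc lam h0.2.2.1,
      aX_apply_eq_zero hP cq hc lam h0.2.2.2]
    simp only [sub_self, abs_zero, mul_zero]
    exact hRHS0
  have hu : uX (ℓ := ℓ) (Mh := Mh) (k := k) (P := P) cq x ≠ 0
      ∨ uX (ℓ := ℓ) (Mh := Mh) (k := k) (P := P) cq ⟨x.1 + Pi.single μ 1, hxe⟩ ≠ 0
      ∨ uX (ℓ := ℓ) (Mh := Mh) (k := k) (P := P) cq x' ≠ 0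
      ∨ uX (ℓ := ℓ) (Mh := Mh) (k := k) (P := P) cq ⟨x'.1 + Pi.single μ 1, hxe'⟩ ≠ 0 := by
    by_contra h'; push Not at h'; exact h0 ⟨h'.1, h'.2.1, h'.2.2.1, h'.2.2.2⟩
  -- the level window at `x` (the level of `x′` is that of `x`)
  have hlevx' : D.lev x'.1 = D.lev x.1 := congrArg (fun s : ↥(bset D) => s.1.1) hblk
  have hwin : fin D cq.1 cq.2 ≤ D.lev x.1 ∧ D.lev x.1 ≤ fin D cq.1 cq.2 + 1 := by
    rcases hu with h | h | h | h
    · exact lev_window_of_uX_or hℓ hR hP hMh2 cq hc x hxe (Or.inl h)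
    · exact lev_window_of_uX_or hℓ hR hP hMh2 cq hc x hxe (Or.inr h)
    · rw [← hlevx']; exact lev_window_of_uX_or hℓ hR hP hMh2 cq hc x' hxe' (Or.inl h)
    · rw [← hlevx']; exact lev_window_of_uX_or hℓ hR hP hMh2 cq hc x' hxe' (Or.inr h)
  have hn1 : (1 : ℝ) ≤ (((ℓ + 1) ^ fin D cq.1 cq.2 : ℕ) : ℝ) := by exact_mod_cast Nat.one_le_pow _ _ (by omega)
  have hn0 : (0 : ℝ) < (((ℓ + 1) ^ fin D cq.1 cq.2 : ℕ) : ℝ) := lt_of_lt_of_le one_pos hn1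
  by_cases hnear : supNorm (x'.1 - x.1) + 1 ≤ 2 * (((ℓ + 1) ^ fin D cq.1 cq.2 : ℕ) : ℝ)
  · -- NEAR PAIRS: §5 with the three cube inputs of the lineage
    have hcM' : ∀ ν, 1 ≤ cubeM' (MhP ℓ Mh cq.1 (fin D cq.1 cq.2)) (Pj ℓ k P cq.1) cq.2 ν := fun ν =>
      Nat.one_le_iff_ne_zero.2 (Nat.mul_ne_zero_iff.2
        ⟨by have := one_le_MhP (ℓ := ℓ) hMh1 cq.1 (fin D cq.1 cq.2); omega,
          by have := (one_le_cubeW (one_le_Pj hP cq.1) hc.hq ν).1; omega⟩)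
    have key := aX_dd_near_le (D := D) (a := a) (c := c) hℓ hMh hR hP cq hc hα1.le (μ := μ) hδ₄pos h41 h42 h43
      hc'.le hcd.le hcH.le
      (fun b => h243 (fin D cq.1 cq.2) (a (fin D cq.1 cq.2)) 0 (c (fin D cq.1 cq.2)) (haw _).1 (haw _).2
        le_rfl le_rfl (hcw _).1 (hcw _).2 _ hcM' _ b)
      (fun i u ue hue => h243d (fin D cq.1 cq.2) (a (fin D cq.1 cq.2)) 0 (c (fin D cq.1 cq.2)) (haw _).1
        (haw _).2 le_rfl le_rfl (hcw _).1 (hcw _).2 _ hcM' _ i u ue hue)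
      (fun u ue u' ue' hue hue' hne' => hH (fin D cq.1 cq.2) (a (fin D cq.1 cq.2)) 0 (c (fin D cq.1 cq.2))
        (haw _).1 (haw _).2 le_rfl le_rfl (hcw _).1 (hcw _).2 _ hcM' _ μ u ue u' ue' hue hue' hne')
      y' lam B hlam x x' hne hblk hxe hxe' hnear hu
    rw [← hQn, ← hE4, ← hLJ] at key
    refine key.trans (mul_le_mul_of_nonneg_left ?_ hLJα0)
    refine mul_le_mul_of_nonneg_right (mul_le_mul_of_nonneg_right ?_ hE40) hB0
    nlinarith [hQ₃.le, hL1]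
  · -- FAR PAIRS: two single bond differences
    have hns : (((ℓ + 1) ^ fin D cq.1 cq.2 : ℕ) : ℝ) ≤ supNorm (x'.1 - x.1) := by
      push Not at hnear; linarith
    have hΔ := hfar k Mh R hMh hR P hP D a c haw hcw μ y' lam B hlam x hxe cq hc
    have hΔ' := hfar k Mh R hMh hR P hP D a c haw hcw μ y' lam B hlam x' hxe' cq hc
    rw [hblk, hlevx'] at hΔ'
    rw [← hLJ] at hΔ hΔ'
    have he3 : Real.exp (-(δ₃ / (d + 1) * (geom D).dist (blkOf D x) y')) ≤ E4 := by
      rw [hE4]; exact exp_rate_mono h44 hdnn d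
    have hT : LJ ≤ ((ℓ : ℝ) + 1) * (((ℓ + 1) ^ fin D cq.1 cq.2 : ℕ) : ℝ) := by
      rw [hLJ]; push_cast
      rw [← pow_succ']
      exact pow_le_pow_right₀ hL1 hwin.2
    have hWL : (supNorm (x'.1 - x.1)) ^ (-α) * LJ ≤ ((ℓ : ℝ) + 1) * LJ ^ (1 - α) :=
      rpow_far_le hn0 hns hLJ0 hT hL1 hα0 hα1.le
    calc (supNorm (x'.1 - x.1)) ^ (-α)
          * |((aX D a c hP cq hc *ᵥ lam) ⟨x'.1 + Pi.single μ 1, hxe'⟩ - (aX D a c hP cq hc *ᵥ lam) x')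
              - ((aX D a c hP cq hc *ᵥ lam) ⟨x.1 + Pi.single μ 1, hxe⟩ - (aX D a c hP cq hc *ᵥ lam) x)|
        ≤ (supNorm (x'.1 - x.1)) ^ (-α)
            * (LJ * (Q₃ * Real.exp (-(δ₃ / (d + 1) * (geom D).dist (blkOf D x) y')) * B)
              + LJ * (Q₃ * Real.exp (-(δ₃ / (d + 1) * (geom D).dist (blkOf D x) y')) * B)) :=
          mul_le_mul_of_nonneg_left ((abs_sub _ _).trans (add_le_add hΔ' hΔ)) hW0
      _ = ((supNorm (x'.1 - x.1)) ^ (-α) * LJ)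
            * (2 * Q₃ * Real.exp (-(δ₃ / (d + 1) * (geom D).dist (blkOf D x) y')) * B) := by ring
      _ ≤ (((ℓ : ℝ) + 1) * LJ ^ (1 - α)) * (2 * Q₃ * E4 * B) := by
          refine mul_le_mul hWL ?_ (by positivity) (by positivity)
          exact mul_le_mul_of_nonneg_right (mul_le_mul_of_nonneg_left he3 (by positivity)) hB0
      _ = LJ ^ (1 - α) * ((2 * ((ℓ : ℝ) + 1) * Q₃) * E4 * B) := by ring
      _ ≤ LJ ^ (1 - α) * ((Qn + 2 * ((ℓ : ℝ) + 1) * Q₃ + 1) * E4 * B) := by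
          refine mul_le_mul_of_nonneg_left ?_ hLJα0
          refine mul_le_mul_of_nonneg_right (mul_le_mul_of_nonneg_right (by linarith) hE40) hB0

end OneTerm

/-! ## §2 The pair-row bound of `T₀ = Dd∘G′₀` (sum over the cover), rate uniform in `α` -/

section ZeroBound

variable {ℓ Mh k R : ℕ} {P : Fin (d + 1) → ℕ}

/-- **THE (2.64)-INPUT FOR THE FOURTH ENTRY, GENUINE `k`-LEVEL OPERATOR, RATE UNIFORM IN `α`** — p21's
`B6Prop22HolderMultiLevelBoxL0.holderZero_rowBound` in the order `∃ δ₅ ∀ α ∈ [0,1) ∃ A(α)`: for every `k`, `M_h ≥ 3`,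
`R ≥ 2L`, volume, nested family `D`, weights in the windows, axis `μ`, every `λ` supported in a block `y′` with `|λ| ≤ B`
and every pair `(x, x′)` of one block `B^j(y)`:
`|x′−x|_∞^{−α}·|((G′₀λ)(x′+e_μ) − (G′₀λ)(x′)) − ((G′₀λ)(x+e_μ) − (G′₀λ)(x))| ≤ A·(L^{j})^{1−α}·e^{−δ₅d(y,y′)/(d+1)}·|λ|` —
the terms of `G′₀ = Σ_□ h_□G′(□)v_□` one by one (§1), at most `12·2^{d+1}` of them meeting the four points.  Proof = the
original with the `∃`-witnesses reordered.
[cite: Balaban1984PropagatorsII, (2.64)–(2.66) p.234 (the G′₀ factor «(L^jη)^{1−α}» of the Hölder entry), (2.43) p.230] -/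
theorem holderZero_rowBound_unif (d ℓ : ℕ) (hℓ : 1 ≤ ℓ) (aminus aplus a2minus a2plus : ℝ) (ha : 0 < aminus)
    (ha2 : 0 < a2minus) :
    ∃ δ₅ : ℝ, 0 < δ₅ ∧ ∀ (α : ℝ), 0 ≤ α → α < 1 → ∃ A : ℝ, 0 < A ∧ ∀ (k Mh R : ℕ), 3 ≤ Mh → 2 * (ℓ + 1) ≤ R →
      ∀ (P : Fin (d + 1) → ℕ) (hP : ∀ μ, 1 ≤ P μ) (D : Domains d ℓ Mh k P R) (a c : ℕ → ℝ),
        (∀ i, aminus ≤ a i ∧ a i ≤ aplus) → (∀ i, a2minus ≤ c i ∧ c i ≤ a2plus) →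
        ∀ (μ : Fin (d + 1)) (y' : ↥(bset D)) (lam : ↥(boxDom (N0 ℓ Mh k P)) → ℝ) (B : ℝ),
          BlockSupp (g := geom D) (blkOf D) lam y' B → ∀ p : HPair D μ,
          |holderOp D μ α (gZeroML D a c hP) lam p|
            ≤ A * (((ℓ : ℝ) + 1) ^ (blkP D μ p).1.1) ^ (1 - α)
              * Real.exp (-(δ₅ / (d + 1) * (geom D).dist (blkP D μ p) y')) * B := by
  obtain ⟨δ₄, hδ₄, hQA⟩ := aX_dd_le_unif d ℓ hℓ aminus aplus a2minus a2plus ha ha2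
  refine ⟨δ₄, hδ₄, fun α hα0 hα1 => ?_⟩
  obtain ⟨Q, hQ, hterm⟩ := hQA α hα0 hα1
  refine ⟨12 * 2 ^ (d + 1) * Q + 1, by positivity, ?_⟩
  intro k Mh R hMh hR P hP D a c haw hcw μ y' lam B hlam p
  have hMh1 : 1 ≤ Mh := le_trans (by norm_num) hMh
  have hMh2 : 2 ≤ Mh := le_trans (by norm_num) hMh
  have hB0 : 0 ≤ B := hlam.nonneg
  have hlev : (blkP D μ p).1.1 = D.lev p.x.1 := rfl
  have hblkP : blkP D μ p = blkOf D p.x := rfl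
  rw [hlev, hblkP]
  obtain ⟨E4, hE4⟩ : ∃ t : ℝ, t = Real.exp (-(δ₄ / (d + 1) * (geom D).dist (blkOf D p.x) y')) := ⟨_, rfl⟩
  obtain ⟨LJ, hLJ⟩ : ∃ t : ℝ, t = (((ℓ : ℝ) + 1) ^ D.lev p.x.1) ^ (1 - α) := ⟨_, rfl⟩
  rw [← hE4, ← hLJ]
  have hE40 : 0 ≤ E4 := by rw [hE4]; exact (Real.exp_pos _).le
  have hLJ0 : 0 ≤ LJ := by rw [hLJ]; exact Real.rpow_nonneg (by positivity) _
  have hs0 : 0 < supNorm (p.x'.1 - p.x.1) :=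
    lt_of_lt_of_le one_pos (B4StripSumsHolder.one_le_supNorm (sub_ne_zero.2 p.ne))
  have hW0 : 0 ≤ (supNorm (p.x'.1 - p.x.1)) ^ (-α) := Real.rpow_nonneg hs0.le _
  -- one term
  obtain ⟨E, hE⟩ : ∃ t : ℝ, t = LJ * (Q * E4 * B) := ⟨_, rfl⟩
  have hEnn : 0 ≤ E := by rw [hE]; positivity
  have hone : ∀ (cq : ℕ × (Fin (d + 1) → ℤ)) (hc : CubeData D cq),
      |(supNorm (p.x'.1 - p.x.1)) ^ (-α)
        * (((aX D a c hP cq hc *ᵥ lam) ⟨p.x'.1 + Pi.single μ 1, p.hxe'⟩ - (aX D a c hP cq hc *ᵥ lam) p.x')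
          - ((aX D a c hP cq hc *ᵥ lam) ⟨p.x.1 + Pi.single μ 1, p.hxe⟩ - (aX D a c hP cq hc *ᵥ lam) p.x))| ≤ E := by
    intro cq hc
    rw [abs_mul, abs_of_nonneg hW0, hE, hLJ, hE4]
    exact hterm k Mh R hMh hR P hP D a c haw hcw μ y' lam B hlam p.x p.x' p.ne p.blk p.hxe p.hxe' cq hc
  -- the sum over the cover
  rw [holderOp_apply]
  unfold gZeroML
  rw [Matrix.sum_mulVec, Finset.sum_apply, Finset.sum_apply, Finset.sum_apply, Finset.sum_apply,
    ← Finset.sum_sub_distrib, ← Finset.sum_sub_distrib, ← Finset.sum_sub_distrib, Finset.mul_sum, Finset.attach_eq_univ]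
  refine (Finset.abs_sum_le_sum_abs _ _).trans ?_
  -- the members with a non-zero term: `h_□ ≠ 0` at one of the four points
  obtain ⟨xe, hxedef⟩ : ∃ t : ↥(boxDom (N0 ℓ Mh k P)), t = ⟨p.x.1 + Pi.single μ 1, p.hxe⟩ := ⟨_, rfl⟩
  obtain ⟨xe', hxe'def⟩ : ∃ t : ↥(boxDom (N0 ℓ Mh k P)), t = ⟨p.x'.1 + Pi.single μ 1, p.hxe'⟩ := ⟨_, rfl⟩
  obtain ⟨T, hTsub, hTcard⟩ : ∃ T : Finset (ℕ × (Fin (d + 1) → ℤ)),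
      (∀ cq, (cq ∈ keySet ℓ Mh (D.lev p.x.1) p.x.1 ∨ cq ∈ keySet ℓ Mh (D.lev xe.1) xe.1)
        ∨ (cq ∈ keySet ℓ Mh (D.lev p.x'.1) p.x'.1 ∨ cq ∈ keySet ℓ Mh (D.lev xe'.1) xe'.1) → cq ∈ T)
        ∧ (T.card : ℝ) ≤ 12 * 2 ^ (d + 1) := by
    refine ⟨(keySet ℓ Mh (D.lev p.x.1) p.x.1 ∪ keySet ℓ Mh (D.lev xe.1) xe.1)
      ∪ (keySet ℓ Mh (D.lev p.x'.1) p.x'.1 ∪ keySet ℓ Mh (D.lev xe'.1) xe'.1), fun cq h => ?_, ?_⟩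
    · simp only [Finset.mem_union]; exact h
    · have h1 := card_keySet_le ℓ Mh (D.lev p.x.1) p.x.1
      have h2 := card_keySet_le ℓ Mh (D.lev xe.1) xe.1
      have h3 := card_keySet_le ℓ Mh (D.lev p.x'.1) p.x'.1
      have h4 := card_keySet_le ℓ Mh (D.lev xe'.1) xe'.1
      have u1 := Finset.card_union_le (keySet ℓ Mh (D.lev p.x.1) p.x.1) (keySet ℓ Mh (D.lev xe.1) xe.1)
      have u2 := Finset.card_union_le (keySet ℓ Mh (D.lev p.x'.1) p.x'.1) (keySet ℓ Mh (D.lev xe'.1) xe'.1)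
      have u3 := Finset.card_union_le (keySet ℓ Mh (D.lev p.x.1) p.x.1 ∪ keySet ℓ Mh (D.lev xe.1) xe.1)
        (keySet ℓ Mh (D.lev p.x'.1) p.x'.1 ∪ keySet ℓ Mh (D.lev xe'.1) xe'.1)
      have h5 : ((keySet ℓ Mh (D.lev p.x.1) p.x.1 ∪ keySet ℓ Mh (D.lev xe.1) xe.1)
          ∪ (keySet ℓ Mh (D.lev p.x'.1) p.x'.1 ∪ keySet ℓ Mh (D.lev xe'.1) xe'.1)).card ≤ 12 * 2 ^ (d + 1) := by
        omega
      exact_mod_cast h5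
  rw [← hxedef, ← hxe'def] at hone ⊢
  have key := sum_le_card_mul
    (fun cq : {cq // cq ∈ cubeSet D} => |(supNorm (p.x'.1 - p.x.1)) ^ (-α)
        * (((aX D a c hP cq.1 (cubeData_of_mem cq.2) *ᵥ lam) xe' - (aX D a c hP cq.1 (cubeData_of_mem cq.2) *ᵥ lam) p.x')
          - ((aX D a c hP cq.1 (cubeData_of_mem cq.2) *ᵥ lam) xe - (aX D a c hP cq.1 (cubeData_of_mem cq.2) *ᵥ lam) p.x))|)
    (fun cq => cq.1) Subtype.val_injective T
    (fun cq hq0 => by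
      by_contra hmem
      apply hq0
      have hux : uX (ℓ := ℓ) (Mh := Mh) (k := k) (P := P) cq.1 p.x = 0 := by
        by_contra h
        exact hmem (hTsub _ (Or.inl (Or.inl (mem_keySet_of_uX_ne_zero hℓ hR hP hMh2 cq.1 (cubeData_of_mem cq.2) h))))
      have huxe : uX (ℓ := ℓ) (Mh := Mh) (k := k) (P := P) cq.1 xe = 0 := by
        by_contra h
        exact hmem (hTsub _ (Or.inl (Or.inr (mem_keySet_of_uX_ne_zero hℓ hR hP hMh2 cq.1 (cubeData_of_mem cq.2) h))))
      have hux' : uX (ℓ := ℓ) (Mh := Mh) (k := k) (P := P) cq.1 p.x' = 0 := by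
        by_contra h
        exact hmem (hTsub _ (Or.inr (Or.inl (mem_keySet_of_uX_ne_zero hℓ hR hP hMh2 cq.1 (cubeData_of_mem cq.2) h))))
      have huxe' : uX (ℓ := ℓ) (Mh := Mh) (k := k) (P := P) cq.1 xe' = 0 := by
        by_contra h
        exact hmem (hTsub _ (Or.inr (Or.inr (mem_keySet_of_uX_ne_zero hℓ hR hP hMh2 cq.1 (cubeData_of_mem cq.2) h))))
      rw [aX_apply_eq_zero hP cq.1 _ lam hux, aX_apply_eq_zero hP cq.1 _ lam huxe,
        aX_apply_eq_zero hP cq.1 _ lam hux', aX_apply_eq_zero hP cq.1 _ lam huxe']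
      simp only [sub_self, mul_zero, abs_zero])
    hEnn (fun cq => hone cq.1 (cubeData_of_mem cq.2))
  refine key.trans ?_
  calc (T.card : ℝ) * E ≤ 12 * 2 ^ (d + 1) * E := mul_le_mul_of_nonneg_right hTcard hEnn
    _ = 12 * 2 ^ (d + 1) * Q * LJ * E4 * B := by rw [hE]; ring
    _ ≤ (12 * 2 ^ (d + 1) * Q + 1) * LJ * E4 * B := by
        have : 0 ≤ LJ * E4 * B := by positivity
        nlinarith
    _ = (12 * 2 ^ (d + 1) * Q + 1) * LJ * E4 * B := rfl

end ZeroBound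

/-! ## §3 Proposition 2.2, fourth entry, for the genuine `k`-level operator — one rate, one threshold for all `α` -/

section Prop22

variable {ℓ Mh k R : ℕ} {P : Fin (d + 1) → ℕ}

/-- **THE LIFTED FOURTH ENTRY HAS A MAJORANT** `C(α)·(L^{j})^{1−α}·e^{−½δ₀d(y,y′)}` on `𝔅`, WITH `δ₀` AND THE THRESHOLDS
`M₀`, `N₀` THE SAME FOR ALL `α ∈ [0,1)` — p21's `B6Prop22HolderMultiLevelBoxL0.hasMajorant_holder_multiLevelBox` in
print's order `∃ δ₀ M₀ N₀ ∀ α ∃ C(α)`: the rate `δ₀ = min(δ_R, δ₅)/(d+1)` (majorant of `R`, §2), the (2.59)-threshold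
`N₀(δ₀)`, the (2.61)-constant `c_K(N₀, δ₀)` and «M sufficiently large» `M₀ = 2K·c_K + 1` are all `α`-free; only
`C = 2A(α)c_K + 1` depends on `α`.  Proof = the original (lifted fixed point `T = T₀ + T·R`, Lemma 2.1 on the box, the
chain (2.64)–(2.66) on `pairs ⊕ sites`) with the `∃`-witnesses reordered.
[cite: Balaban1984PropagatorsII, Proposition 2.2 (2.67) p.234 (fourth entry), (2.64)–(2.66) p.234] -/
theorem hasMajorant_holder_multiLevelBox_unif (d ℓ : ℕ) (hℓ : 1 ≤ ℓ) (aminus aplus a2minus a2plus : ℝ)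
    (ha : 0 < aminus) (ha2 : 0 < a2minus) :
    ∃ δ₀ M₀ : ℝ, ∃ N₀ : ℕ, 0 < δ₀ ∧ 0 < M₀ ∧ 0 < N₀ ∧ ∀ (α : ℝ), 0 ≤ α → α < 1 → ∃ C : ℝ, 0 < C ∧
      ∀ (k Mh R : ℕ), 3 ≤ Mh → M₀ ≤ ((ℓ : ℝ) + 1) * Mh → 2 * (ℓ + 1) ≤ R → N₀ + 1 ≤ R * ((ℓ + 1) * Mh) →
      ∀ (P : Fin (d + 1) → ℕ) (hP : ∀ μ, 1 ≤ P μ) (D : Domains d ℓ Mh k P R) (a c : ℕ → ℝ),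
        (∀ i, aminus ≤ a i ∧ a i ≤ aplus) → (∀ i, a2minus ≤ c i ∧ c i ≤ a2plus) →
        (∀ i, a (i + 1) = aNext ℓ (a i) (c i)) → ∀ μ : Fin (d + 1),
        HasMajorant (g := geom D) (Sum.elim (blkP D μ) (blkOf D))
          (liftL (holderOp D μ α (gml (N0 ℓ Mh k P) ℓ k D.lev a)))
          (fun y y' => C * (((ℓ : ℝ) + 1) ^ y.1.1) ^ (1 - α) * Real.exp (-(δ₀ / 2 * (geom D).dist y y'))) := by
  obtain ⟨δ₁, K, hδ₁, hK, hRmaj⟩ := rML_majorant d ℓ hℓ aminus aplus a2minus a2plus ha ha2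
  obtain ⟨δ₂, hδ₂, hGrowA⟩ := holderZero_rowBound_unif d ℓ hℓ aminus aplus a2minus a2plus ha ha2
  have hL0 : (0 : ℝ) < (ℓ : ℝ) + 1 := by positivity
  have hL1 : (1 : ℝ) ≤ (ℓ : ℝ) + 1 := by linarith [(Nat.cast_nonneg ℓ : (0 : ℝ) ≤ ℓ)]
  -- the rate `δ₀ = min(δ₁, δ₂)/(d+1)` and the (2.59)-threshold `N₀`
  set δ₀ : ℝ := min δ₁ δ₂ / (d + 1) with hδ₀
  have hδ₀pos : 0 < δ₀ := by rw [hδ₀]; exact div_pos (lt_min hδ₁ hδ₂) (by positivity)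
  set N₀ : ℕ := ⌈4 * ((d : ℝ) + 1) * ((ℓ : ℝ) + 1) / (1 / 2 * δ₀)⌉₊ + 1 with hN₀
  have hN₀pos : 0 < N₀ := by rw [hN₀]; omega
  have hθlt : Real.exp (-(1 / 2 * δ₀)) * ((ℓ : ℝ) + 1) ^ ((2 * (d + 1 : ℕ) : ℝ) / N₀) < 1 := by
    refine theta_lt_one_of_log hL0 hN₀pos ?_
    have hlog : Real.log ((ℓ : ℝ) + 1) ≤ (ℓ : ℝ) + 1 := (Real.log_le_sub_one_of_pos hL0).trans (by linarith)
    have hN₀ge : 4 * ((d : ℝ) + 1) * ((ℓ : ℝ) + 1) / (1 / 2 * δ₀) < (N₀ : ℝ) := by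
      rw [hN₀]; push_cast
      exact lt_of_le_of_lt (Nat.le_ceil _) (by linarith)
    have hσ : (0 : ℝ) < 1 / 2 * δ₀ := by positivity
    rw [div_lt_iff₀ hσ] at hN₀ge
    push_cast
    nlinarith [mul_nonneg (by positivity : (0 : ℝ) ≤ 2 * ((d : ℝ) + 1)) (Real.log_nonneg hL1)]
  -- the (2.61)-constant and «M sufficiently large»
  set cK : ℝ := K261 N₀ (d + 1) ((ℓ : ℝ) + 1) 1 (1 / 2 * δ₀) with hcK
  have hcK0 : 0 ≤ cK := K261_nonneg (by positivity) zero_le_one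
  set M₀ : ℝ := 2 * K * cK + 1 with hM₀
  refine ⟨δ₀, M₀, N₀, hδ₀pos, by positivity, hN₀pos, fun α hα0 hα1 => ?_⟩
  obtain ⟨A, hA, hGrow⟩ := hGrowA α hα0 hα1
  refine ⟨2 * A * cK + 1, by positivity, ?_⟩
  intro k Mh R hMh hM hR hRM P hP D a c haw hcw hac μ
  have hMh1 : 1 ≤ Mh := le_trans (by norm_num) hMh
  have hMh2 : 2 ≤ Mh := le_trans (by norm_num) hMh
  have hMpos : (0 : ℝ) < ((ℓ : ℝ) + 1) * Mh := by
    have : (1 : ℝ) ≤ Mh := by exact_mod_cast hMh1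
    positivity
  -- the majorants of the lifted `R` and of the lifted `T₀`, at the common rate `δ₀`
  set θ : ℝ := K / (((ℓ : ℝ) + 1) * Mh) with hθ
  have hθ0 : 0 ≤ θ := by positivity
  have hdnn : ∀ y y' : (geom D).Site, 0 ≤ (geom D).dist y y' := (triangle_refl_nonneg D hMh1 hP).2.2
  have hrate : ∀ (δ : ℝ), min δ₁ δ₂ ≤ δ → ∀ y y' : (geom D).Site,
      Real.exp (-(δ / (d + 1) * (geom D).dist y y')) ≤ Real.exp (-(δ₀ * (geom D).dist y y')) := by
    intro δ hδ y y'
    rw [Real.exp_le_exp, hδ₀, neg_le_neg_iff]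
    exact mul_le_mul_of_nonneg_right (div_le_div_of_nonneg_right hδ (by positivity)) (hdnn y y')
  have hRm0 : HasMajorant (g := geom D) (blkOf D) (Matrix.toLin' (rML D a c hP))
      (fun y y' => θ * Real.exp (-(δ₀ * (geom D).dist y y'))) :=
    hasMajorant_mono (blkOf D) (hRmaj k Mh R hMh hR P hP D a c haw hcw) fun y y' =>
      mul_le_mul_of_nonneg_left (hrate δ₁ (min_le_left _ _) y y') hθ0
  have hRm : HasMajorant (g := geom D) (Sum.elim (blkP D μ) (blkOf D))
      (liftR (Y := HPair D μ) (Matrix.toLin' (rML D a c hP)))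
      (fun y y' => θ * Real.exp (-(δ₀ * (geom D).dist y y'))) :=
    hasMajorant_liftR (g := geom D) (blkOf D) (blkP D μ) (K := fun y y' => θ * Real.exp (-(δ₀ * (geom D).dist y y')))
      (fun y y' => by positivity) hRm0
  have hGm : HasMajorant (g := geom D) (Sum.elim (blkP D μ) (blkOf D))
      (liftL (holderOp D μ α (gZeroML D a c hP)))
      (fun y y' => A * (((ℓ : ℝ) + 1) ^ y.1.1) ^ (1 - α) * Real.exp (-(δ₀ * (geom D).dist y y'))) := by
    refine hasMajorant_liftL (g := geom D) (blkOf D) (blkP D μ)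
      (K := fun y y' => A * (((ℓ : ℝ) + 1) ^ y.1.1) ^ (1 - α) * Real.exp (-(δ₀ * (geom D).dist y y')))
      (fun y y' => by positivity) fun y' lam B hlam p => ?_
    refine (hGrow k Mh R hMh hR P hP D a c haw hcw μ y' lam B hlam p).trans ?_
    refine mul_le_mul_of_nonneg_right ?_ hlam.nonneg
    exact mul_le_mul_of_nonneg_left (hrate δ₂ (min_le_right _ _) _ _) (by positivity)
  -- Lemma 2.1 on the box with `α′ = ½`
  obtain ⟨-, h261, -, h263⟩ := lemma21_box D hMh1 hP hN₀pos hRM hδ₀pos.le (α := 1 / 2) (by norm_num)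
    (by norm_num) hθlt
  obtain ⟨htri, hrefl, -⟩ := triangle_refl_nonneg D hMh1 hP
  -- the smallness `θ·c < 1` from `M ≥ M₀`
  have hsmall : θ * cK ≤ 1 / 2 := by
    rw [hθ, div_mul_eq_mul_div, div_le_iff₀ hMpos]
    have : 2 * K * cK + 1 ≤ ((ℓ : ℝ) + 1) * Mh := hM
    nlinarith
  have hsmall' : θ * cK < 1 := by linarith
  -- the lifted fixed point and the chain on `pairs ⊕ sites`
  have hfix := fixedPoint_holder D (c := c) hℓ hR hP hMh2 (fun i => lt_of_lt_of_le ha (haw i).1)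
    (fun i => lt_of_lt_of_le ha2 (hcw i).1) hac μ α
  have hchain := majorant_of_fixedPoint_266W (g := geom D) (Sum.elim (blkP D μ) (blkOf D)) cK δ₀ (1 / 2) θ A
    (fun y => (((ℓ : ℝ) + 1) ^ y.1.1) ^ (1 - α)) hA.le (fun y => Real.rpow_nonneg (by positivity) _) hθ0 hcK0
    (by nlinarith [hδ₀pos.le] : (0 : ℝ) ≤ (1 - 1 / 2) * δ₀) htri hrefl hdnn h261 h263 hsmall' hGm hRm hfix
  refine hasMajorant_mono (g := geom D) (Sum.elim (blkP D μ) (blkOf D)) hchain fun y y' => ?_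
  have hinv : (1 - θ * cK)⁻¹ ≤ 2 := by
    rw [inv_le_comm₀ (by linarith) (by norm_num)]; linarith
  have hexp0 : 0 ≤ Real.exp (-((1 - 1 / 2) * δ₀ * (geom D).dist y y')) := (Real.exp_pos _).le
  have hP0 : 0 ≤ (((ℓ : ℝ) + 1) ^ y.1.1) ^ (1 - α) := Real.rpow_nonneg (by positivity) _
  have hrate2 : Real.exp (-((1 - 1 / 2) * δ₀ * (geom D).dist y y')) = Real.exp (-(δ₀ / 2 * (geom D).dist y y')) := by
    congr 1; ring
  rw [← hrate2]
  have h1 : A * cK * (1 - θ * cK)⁻¹ ≤ 2 * A * cK + 1 := by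
    have : A * cK * (1 - θ * cK)⁻¹ ≤ A * cK * 2 := mul_le_mul_of_nonneg_left hinv (by positivity)
    linarith
  calc A * cK * (1 - θ * cK)⁻¹ * (((ℓ : ℝ) + 1) ^ y.1.1) ^ (1 - α) * Real.exp (-((1 - 1 / 2) * δ₀ * (geom D).dist y y'))
      = A * cK * (1 - θ * cK)⁻¹
        * ((((ℓ : ℝ) + 1) ^ y.1.1) ^ (1 - α) * Real.exp (-((1 - 1 / 2) * δ₀ * (geom D).dist y y'))) := by ring
    _ ≤ (2 * A * cK + 1) * ((((ℓ : ℝ) + 1) ^ y.1.1) ^ (1 - α) * Real.exp (-((1 - 1 / 2) * δ₀ * (geom D).dist y y'))) :=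
        mul_le_mul_of_nonneg_right h1 (mul_nonneg hP0 hexp0)
    _ = (2 * A * cK + 1) * (((ℓ : ℝ) + 1) ^ y.1.1) ^ (1 - α) * Real.exp (-((1 - 1 / 2) * δ₀ * (geom D).dist y y')) := by
        ring

/-- **[B6] PROPOSITION 2.2, FOURTH ENTRY OF (2.67) (`‖ζ∇^η_xG′λ‖_α`), FOR THE GENUINE `k`-LEVEL OPERATOR
`G′ = Δ′_a^{−1}` ON A BOX, IN THE PRINTED QUANTIFIER ORDER**: there are `δ₀, M₀ > 0` and `N₀ ≥ 1` (functions of `d`,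
`ℓ`, the windows) such that for every `0 ≤ α < 1` there is `C = C(α) > 0` with: for EVERY number of levels `k`, `M_h ≥ 3`
with `L·M_h ≥ M₀` («M is sufficiently large»), `R ≥ 2L` with `RM ≥ N₀ + 1` ((2.59)), volume `P`, nested family `D` of
domains (2.1)–(2.2), weights `a_i ∈ [a₋, a₊]`, `c_i ∈ [c₋, c₊]` with `a_{i+1} = aNext ℓ a_i c_i`, axis `μ`, and all
`x ≠ x′` of one block `B^j(y)` with `x + e_μ`, `x′ + e_μ` in the box:
`|x′−x|_∞^{−α}·|((G′λ)(x′+e_μ) − (G′λ)(x′)) − ((G′λ)(x+e_μ) − (G′λ)(x))| ≤ C·(L^{j})^{1−α}·e^{−½δ₀d(y,y′)}·|λ|`,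
`supp λ ⊂ B^{j′}(y′)` (lattice units, as in the original `prop22_fourth_multiLevelBox`; «δ₀» of print does not depend on
`α`, [3] p. 573 «δ₀ … depending on d, M only, c₀ on α also»).
[cite: Balaban1984PropagatorsII, Proposition 2.2 (2.67) p.234 (fourth entry «(L^jη)^{1−α}(‖ζ‖_α + |ζ|)»), (2.64)–(2.66) p.234; Balaban1983RegularityDecay, Theorem (1.9) p.573] -/
theorem prop22_fourth_multiLevelBox_unif (d ℓ : ℕ) (hℓ : 1 ≤ ℓ) (aminus aplus a2minus a2plus : ℝ) (ha : 0 < aminus)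
    (ha2 : 0 < a2minus) :
    ∃ δ₀ M₀ : ℝ, ∃ N₀ : ℕ, 0 < δ₀ ∧ 0 < M₀ ∧ 0 < N₀ ∧ ∀ (α : ℝ), 0 ≤ α → α < 1 → ∃ C : ℝ, 0 < C ∧
      ∀ (k Mh R : ℕ), 3 ≤ Mh → M₀ ≤ ((ℓ : ℝ) + 1) * Mh → 2 * (ℓ + 1) ≤ R → N₀ + 1 ≤ R * ((ℓ + 1) * Mh) →
      ∀ (P : Fin (d + 1) → ℕ) (hP : ∀ μ, 1 ≤ P μ) (D : Domains d ℓ Mh k P R) (a c : ℕ → ℝ),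
        (∀ i, aminus ≤ a i ∧ a i ≤ aplus) → (∀ i, a2minus ≤ c i ∧ c i ≤ a2plus) →
        (∀ i, a (i + 1) = aNext ℓ (a i) (c i)) →
        ∀ (μ : Fin (d + 1)) (y' : ↥(bset D)) (lam : ↥(boxDom (N0 ℓ Mh k P)) → ℝ) (B : ℝ),
          BlockSupp (g := geom D) (blkOf D) lam y' B →
          ∀ (x x' : ↥(boxDom (N0 ℓ Mh k P))), x'.1 ≠ x.1 → blkOf D x' = blkOf D x →
          ∀ (hxe : x.1 + Pi.single μ 1 ∈ boxDom (N0 ℓ Mh k P)) (hxe' : x'.1 + Pi.single μ 1 ∈ boxDom (N0 ℓ Mh k P)),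
            (supNorm (x'.1 - x.1)) ^ (-α)
                * |((gml (N0 ℓ Mh k P) ℓ k D.lev a *ᵥ lam) ⟨x'.1 + Pi.single μ 1, hxe'⟩
                      - (gml (N0 ℓ Mh k P) ℓ k D.lev a *ᵥ lam) x')
                    - ((gml (N0 ℓ Mh k P) ℓ k D.lev a *ᵥ lam) ⟨x.1 + Pi.single μ 1, hxe⟩
                      - (gml (N0 ℓ Mh k P) ℓ k D.lev a *ᵥ lam) x)|
              ≤ C * (((ℓ : ℝ) + 1) ^ D.lev x.1) ^ (1 - α) * Real.exp (-(δ₀ / 2 * (geom D).dist (blkOf D x) y')) * B := by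
  obtain ⟨δ₀, M₀, N₀, hδ₀, hM₀, hN₀, hCA⟩ :=
    hasMajorant_holder_multiLevelBox_unif d ℓ hℓ aminus aplus a2minus a2plus ha ha2
  refine ⟨δ₀, M₀, N₀, hδ₀, hM₀, hN₀, fun α hα0 hα1 => ?_⟩
  obtain ⟨C, hC, h⟩ := hCA α hα0 hα1
  refine ⟨C, hC, ?_⟩
  intro k Mh R hMh hM hR hRM P hP D a c haw hcw hac μ y' lam B hlam x x' hne hblk hxe hxe'
  have hmaj := h k Mh R hMh hM hR hRM P hP D a c haw hcw hac μ
  have hrow := rowBound_of_hasMajorant_liftL (g := geom D) (blkOf D) (blkP D μ) hmaj y' lam B hlam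
    (⟨x, x', hne, hblk, hxe, hxe'⟩ : HPair D μ)
  rw [holderOp_apply, abs_mul, abs_of_nonneg (Real.rpow_nonneg (supNorm_nonneg _) _)] at hrow
  exact hrow

end Prop22

end

end Literature.MathematicalPhysics.QuantumFieldTheory.Balaban1983to89.B6Prop22HolderMultiLevelBoxRateUnifL0
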